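import Mathlib.MeasureTheory.Integral.IntegralEqImproper
import Mathlib.MeasureTheory.Integral.ExpDecay
import Mathlib.MeasureTheory.Integral.DominatedConvergence
import Mathlib.Analysis.SpecialFunctions.ImproperIntegrals
import Mathlib.Analysis.SpecialFunctions.Integrals.Basic
import Mathlib.Analysis.Calculus.ParametricIntegral
import Mathlib.Analysis.SpecialFunctions.Pow.Deriv
import Mathlib.Analysis.SpecialFunctions.Pow.Asymptotics
import Literature.NumberTheory.Sieve.SieveAdjoint
import HarnessLib

/-!
# The adjoint function `p_κ` of the Rosser–Iwaniec `β`-sieve as a Laplace transform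

Trunk `AntSieve` (topic `NumberTheory/Sieve`). [Greaves2001, §4.2.3 (3.4)–(3.8)] solves the
adjoint equation `(s r(s))' = a r(s) + b r(s + 1)` for `a + b < 1` by the Laplace transform
`r(s) = Γ(1 − a − b)⁻¹ ∫_0^∞ e^{−sx} Φ_b(−x) x^{−(a+b)} dx`, `Φ_b(x) = exp{b ∫_0^x (1 − e^t)/t dt}`
((3.6)–(3.7)), with `r(s) ∼ s^{a+b−1}` ((3.8)). For `(a, b) = (κ, −κ)` this is Iwaniec's
function `p = p_κ = r_{κ,−κ}` ((3.17)), the adjoint of the equation for `P = F + f`: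
`p_κ(s) = ∫_0^∞ exp(−s x − κ Ein(x)) dx`, `Ein(x) = ∫_0^x (1 − e^{−t})/t dt`, with
`(s p(s))' = κ p(s) − κ p(s + 1)` and `s p(s) → 1`. This file constructs `Ein` and `p_κ` and
PROVES these properties (for `κ ≥ 0`); together with `IsBetaSieveSolution.const_eq` of
`SieveAdjoint` they identify the constant `A_κ = 2(β_κ − 1)^{κ−1}/p_κ(β_κ − 1)` of the `β`-sieve
[Greaves2001, Lemma 4.2.5 (4.11)].

## Main definitions and results

* `einKernel t = ∫_0^1 e^{−tu} du` (`= (1 − e^{−t})/t` for `t ≠ 0`, `= 1` at `t = 0`), `ein x =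
  ∫_0^x einKernel = Ein(x)`; `hasDerivAt_ein`, `ein_nonneg`, `ein_le_self`.
* `rosserAdjointP κ s = ∫_{x > 0} exp(−s x − κ Ein x) dx`; `rosserAdjointP_pos`;
  `hasDerivAt_mul_rosserAdjointP` (`(s p)' = κ p(s) − κ p(s+1)`, [Greaves2001, (3.4)–(3.6)]);
  `hasDerivAt_rpow_mul_rosserAdjointP` (the form `(s^{1−κ} p)' = −κ s^{−κ} p(s+1)` used by
  `IsSieveAdjoint κ (−κ)`); `tendsto_mul_rosserAdjointP` (`s p(s) → 1`, [Greaves2001, (3.8)]).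

## References

* [Greaves2001] G. Greaves, *Sieves in Number Theory*, Springer (2001), §4.2.3 (3.4)–(3.8), (3.17);
  Lemma 4.2.5 (4.11).
-/

open Filter Asymptotics Set Topology MeasureTheory intervalIntegral

noncomputable section

namespace Literature.NumberTheory.Sieve

/-! ### The entire exponential integral `Ein` -/

/-- The kernel `g(t) = ∫_0^1 e^{−tu} du`, i.e. `(1 − e^{−t})/t` for `t ≠ 0` extended by its limit
`1` at `t = 0` (`einKernel_eq_div`); written as a parametric integral so that continuity in `t` is
immediate. [folklore] -/
def einKernel (t : ℝ) : ℝ :=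
  ∫ u in (0 : ℝ)..1, Real.exp (-(t * u))

/-- `einKernel` is continuous. [folklore] -/
theorem continuous_einKernel : Continuous einKernel :=
  intervalIntegral.continuous_parametric_intervalIntegral_of_continuous' (by fun_prop) 0 1

/-- `t · g(t) = 1 − e^{−t}` for every `t`. [folklore] -/
theorem mul_einKernel (t : ℝ) : t * einKernel t = 1 - Real.exp (-t) := by
  rcases eq_or_ne t 0 with rfl | ht
  · simp
  have hderiv : ∀ u ∈ uIcc (0 : ℝ) 1,
      HasDerivAt (fun u : ℝ => -Real.exp (-(t * u))) (t * Real.exp (-(t * u))) u := by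
    intro u _
    have h1 : HasDerivAt (fun u : ℝ => -(t * u)) (-t) u := by
      have := ((hasDerivAt_id u).const_mul t).neg
      simp only [id, mul_one] at this
      exact this
    exact h1.exp.neg.congr_deriv (by ring)
  have := intervalIntegral.integral_eq_sub_of_hasDerivAt hderiv
    ((Continuous.continuousOn (by fun_prop)).intervalIntegrable)
  rw [intervalIntegral.integral_const_mul] at this
  rw [einKernel, this]
  simp only [mul_one, mul_zero, neg_zero, Real.exp_zero]
  ring

/-- `g(t) = (1 − e^{−t})/t` for `t ≠ 0`. [folklore] -/
theorem einKernel_eq_div {t : ℝ} (ht : t ≠ 0) : einKernel t = (1 - Real.exp (-t)) / t := by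
  rw [← mul_einKernel, mul_div_cancel_left₀ _ ht]

/-- `g(0) = 1`. [folklore] -/
theorem einKernel_zero : einKernel 0 = 1 := by simp [einKernel]

/-- `0 < g(t)`. [folklore] -/
theorem einKernel_pos (t : ℝ) : 0 < einKernel t :=
  intervalIntegral.intervalIntegral_pos_of_pos (Continuous.intervalIntegrable (by fun_prop) 0 1)
    (fun u => Real.exp_pos _) one_pos

/-- `g(t) ≤ 1` for `t ≥ 0`. [folklore] -/
theorem einKernel_le_one {t : ℝ} (ht : 0 ≤ t) : einKernel t ≤ 1 := by
  have h : ∫ u in (0 : ℝ)..1, Real.exp (-(t * u)) ≤ ∫ _ in (0 : ℝ)..1, (1 : ℝ) := by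
    refine intervalIntegral.integral_mono_on zero_le_one
      (Continuous.intervalIntegrable (by fun_prop) 0 1) (by simp) fun u hu => ?_
    rw [Real.exp_le_one_iff]
    nlinarith [hu.1]
  simpa [einKernel] using h

/-- `Ein(x) = ∫_0^x (1 − e^{−t})/t dt`, the entire exponential integral (so that
`Φ_{−κ}(−x) = exp(−κ Ein(x))` in the notation of [Greaves2001, (3.7)]). [folklore] -/
def ein (x : ℝ) : ℝ :=
  ∫ t in (0 : ℝ)..x, einKernel t

/-- `Ein' = g`. [folklore] -/
theorem hasDerivAt_ein (x : ℝ) : HasDerivAt ein (einKernel x) x :=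
  (continuous_einKernel.integral_hasStrictDerivAt 0 x).hasDerivAt

/-- `Ein` is continuous. [folklore] -/
theorem continuous_ein : Continuous ein :=
  continuous_iff_continuousAt.mpr fun x => (hasDerivAt_ein x).continuousAt

/-- `Ein(0) = 0`. [folklore] -/
theorem ein_zero : ein 0 = 0 := by simp [ein]

/-- `0 ≤ Ein(x)` for `x ≥ 0`. [folklore] -/
theorem ein_nonneg {x : ℝ} (hx : 0 ≤ x) : 0 ≤ ein x :=
  intervalIntegral.integral_nonneg hx fun t _ => (einKernel_pos t).le

/-- `Ein(x) ≤ x` for `x ≥ 0`. [folklore] -/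
theorem ein_le_self {x : ℝ} (hx : 0 ≤ x) : ein x ≤ x := by
  have h : ∫ t in (0 : ℝ)..x, einKernel t ≤ ∫ _ in (0 : ℝ)..x, (1 : ℝ) :=
    intervalIntegral.integral_mono_on hx (continuous_einKernel.intervalIntegrable 0 x) (by simp)
      fun t ht => einKernel_le_one ht.1
  simpa [ein] using h

/-- `Ein` is monotone on `[0, ∞)` (indeed everywhere: `Ein' = g > 0`). [folklore] -/
theorem ein_monotone : Monotone ein :=
  monotone_of_hasDerivAt_nonneg (f := ein) (fun x => hasDerivAt_ein x)
    fun x => (einKernel_pos x).le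

/-! ### The Laplace transform `p_κ` [Greaves2001, (3.6)–(3.7), (3.17)] -/

/-- `rosserAdjointP κ s = p_κ(s) = ∫_0^∞ exp(−s x − κ Ein(x)) dx`, the Laplace-transform solution
[Greaves2001, §4.2.3 (3.6)–(3.7) with `(a, b) = (κ, −κ)`, and (3.17)] of the equation
`(s p(s))' = κ p(s) − κ p(s + 1)` adjoint to the equation for `P = F + f`; meaningful for `s > 0`
(for `s ≤ 0` the integrand is not integrable and the Bochner integral is `0`).
[cite: Greaves2001, §4.2.3 (3.6)–(3.7) and (3.17)] -/
def rosserAdjointP (κ s : ℝ) : ℝ :=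
  ∫ x in Ioi 0, Real.exp (-(s * x) - κ * ein x)

/-- Unfolding lemma. [folklore] -/
theorem rosserAdjointP_def (κ s : ℝ) :
    rosserAdjointP κ s = ∫ x in Ioi 0, Real.exp (-(s * x) - κ * ein x) :=
  rfl

namespace rosserAdjointP

/-- The integrand is continuous in `x`. [folklore] -/
theorem continuous_integrand (κ s : ℝ) :
    Continuous fun x : ℝ => Real.exp (-(s * x) - κ * ein x) := by
  have := continuous_ein
  fun_prop

/-- For `κ ≥ 0` and `x ≥ 0` the integrand is at most `e^{−sx}`. [folklore] -/
theorem integrand_le {κ : ℝ} (hκ : 0 ≤ κ) (s : ℝ) {x : ℝ} (hx : 0 ≤ x) :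
    Real.exp (-(s * x) - κ * ein x) ≤ Real.exp (-(s * x)) := by
  rw [Real.exp_le_exp]
  nlinarith [ein_nonneg hx]

/-- Multiplying the integrand by `e^{−x}` shifts `s` to `s + 1`. [folklore] -/
theorem integrand_mul_exp_neg (κ s x : ℝ) :
    Real.exp (-(s * x) - κ * ein x) * Real.exp (-x) = Real.exp (-((s + 1) * x) - κ * ein x) := by
  rw [← Real.exp_add]; ring_nf

/-- Integrability on `(0, ∞)` of a continuous function dominated by `x^k e^{−sx}` (`s > 0`).
[folklore] -/
theorem _root_.Literature.NumberTheory.Sieve.integrableOn_Ioi_of_le_pow_mul_exp {h : ℝ → ℝ} {s : ℝ} (hs : 0 < s) (k : ℕ)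
    (hh : ContinuousOn h (Ici 0)) (hb : ∀ x, 0 ≤ x → |h x| ≤ x ^ k * Real.exp (-(s * x))) :
    IntegrableOn h (Ioi 0) := by
  refine integrable_of_isBigO_exp_neg (half_pos hs) hh ?_
  have h1 : h =O[atTop] fun x => x ^ k * Real.exp (-(s * x)) := by
    refine IsBigO.of_bound 1 ?_
    filter_upwards [eventually_ge_atTop (0 : ℝ)] with x hx
    rw [one_mul, Real.norm_eq_abs, Real.norm_of_nonneg (by positivity)]
    exact hb x hx
  have h2 : (fun x : ℝ => x ^ k * Real.exp (-(s * x))) =o[atTop]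
      fun x => Real.exp (s / 2 * x) * Real.exp (-(s * x)) :=
    (isLittleO_pow_exp_pos_mul_atTop k (half_pos hs)).mul_isBigO (isBigO_refl _ _)
  refine (h1.trans h2.isBigO).trans (IsBigO.of_bound 1 (Eventually.of_forall fun x => ?_))
  rw [← Real.exp_add, one_mul, Real.norm_eq_abs, Real.norm_eq_abs, Real.abs_exp, Real.abs_exp,
    Real.exp_le_exp]
  linarith

/-- The integrand `x^k e^{−sx − κ Ein x}` is integrable on `(0, ∞)` (`κ ≥ 0`, `s > 0`). [folklore] -/
theorem integrableOn_pow_mul_integrand {κ s : ℝ} (hκ : 0 ≤ κ) (hs : 0 < s) (k : ℕ) :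
    IntegrableOn (fun x : ℝ => x ^ k * Real.exp (-(s * x) - κ * ein x)) (Ioi 0) := by
  refine integrableOn_Ioi_of_le_pow_mul_exp hs k
    ((continuous_pow k).mul (continuous_integrand κ s)).continuousOn fun x hx => ?_
  rw [abs_of_nonneg (by positivity)]
  exact mul_le_mul_of_nonneg_left (integrand_le hκ s hx) (by positivity)

/-- The integrand is integrable on `(0, ∞)` (`κ ≥ 0`, `s > 0`). [folklore] -/
theorem integrableOn_integrand {κ s : ℝ} (hκ : 0 ≤ κ) (hs : 0 < s) :
    IntegrableOn (fun x : ℝ => Real.exp (-(s * x) - κ * ein x)) (Ioi 0) := by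
  simpa using integrableOn_pow_mul_integrand hκ hs 0

/-- The integrand `x e^{−sx − κ Ein x}` is integrable on `(0, ∞)` (`κ ≥ 0`, `s > 0`). [folklore] -/
theorem integrableOn_mul_integrand {κ s : ℝ} (hκ : 0 ≤ κ) (hs : 0 < s) :
    IntegrableOn (fun x : ℝ => x * Real.exp (-(s * x) - κ * ein x)) (Ioi 0) := by
  simpa using integrableOn_pow_mul_integrand hκ hs 1

/-- `p_κ(s) > 0` for `κ ≥ 0`, `s > 0`. [folklore] -/
theorem pos {κ s : ℝ} (hκ : 0 ≤ κ) (hs : 0 < s) : 0 < rosserAdjointP κ s := by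
  rw [rosserAdjointP_def]
  have hsupp : Function.support (fun x : ℝ => Real.exp (-(s * x) - κ * ein x)) = univ := by
    ext x
    simp [(Real.exp_pos _).ne']
  rw [setIntegral_pos_iff_support_of_nonneg_ae (Eventually.of_forall fun x => (Real.exp_pos _).le)
    (integrableOn_integrand hκ hs), hsupp, univ_inter]
  simp

/-- `p_κ` is antitone in `s` on `(0, ∞)` (`κ ≥ 0`): the integrand decreases with `s`. [folklore] -/
theorem antitoneOn {κ : ℝ} (hκ : 0 ≤ κ) : AntitoneOn (rosserAdjointP κ) (Ioi 0) := by
  intro s (hs : 0 < s) s' (_ : 0 < s') hss'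
  rw [rosserAdjointP_def, rosserAdjointP_def]
  refine setIntegral_mono_on (integrableOn_integrand hκ (hs.trans_le hss'))
    (integrableOn_integrand hκ hs) measurableSet_Ioi fun x (hx : 0 < x) => ?_
  rw [Real.exp_le_exp]
  nlinarith

/-- `p_κ(x + 1) ≤ p_κ(s)` for `s − 1 ≤ x`, `s > 0` (the comparability used in the delay
inequality for `P − 2`). [folklore] -/
theorem apply_add_one_le {κ s x : ℝ} (hκ : 0 ≤ κ) (hs : 0 < s) (hx : s - 1 ≤ x) :
    rosserAdjointP κ (x + 1) ≤ rosserAdjointP κ s :=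
  antitoneOn hκ hs (show 0 < x + 1 by linarith) (by linarith)

/-! ### Differentiation under the integral sign -/

/-- `p_κ'(s) = −∫_0^∞ x e^{−sx − κ Ein x} dx` for `κ ≥ 0`, `s > 0` (dominated differentiation,
dominating function `x e^{−(s/2) x}` on `|s' − s| < s/2`). [folklore] -/
theorem hasDerivAt {κ s : ℝ} (hκ : 0 ≤ κ) (hs : 0 < s) :
    HasDerivAt (rosserAdjointP κ)
      (-∫ x in Ioi 0, x * Real.exp (-(s * x) - κ * ein x)) s := by
  rw [← MeasureTheory.integral_neg]
  have hball : Metric.ball s (s / 2) ∈ 𝓝 s := Metric.ball_mem_nhds s (half_pos hs)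
  have hmem : ∀ s' ∈ Metric.ball s (s / 2), s / 2 < s' := by
    intro s' hs'
    rw [Metric.mem_ball, Real.dist_eq] at hs'
    linarith [(abs_lt.mp hs').1]
  have key := hasDerivAt_integral_of_dominated_loc_of_deriv_le (μ := volume.restrict (Ioi 0))
    (F := fun s' x => Real.exp (-(s' * x) - κ * ein x))
    (F' := fun s' x => -(x * Real.exp (-(s' * x) - κ * ein x)))
    (bound := fun x => x ^ 1 * Real.exp (-(s / 2 * x))) hball ?_ ?_ ?_ ?_ ?_ ?_
  · exact key.2
  · exact Eventually.of_forall fun s' => (continuous_integrand κ s').aestronglyMeasurable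
  · exact integrableOn_integrand hκ hs
  · exact ((continuous_id.mul (continuous_integrand κ s)).neg).aestronglyMeasurable
  · refine (ae_restrict_mem measurableSet_Ioi).mono fun x (hx : 0 < x) s' hs' => ?_
    rw [norm_neg, Real.norm_of_nonneg (by positivity), pow_one]
    refine mul_le_mul_of_nonneg_left ?_ hx.le
    refine (integrand_le hκ s' hx.le).trans ?_
    rw [Real.exp_le_exp]
    nlinarith [hmem s' hs']
  · have h0 := integrableOn_pow_mul_integrand (κ := 0) le_rfl (half_pos hs) 1
    simp only [zero_mul, sub_zero] at h0
    exact h0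
  · refine Eventually.of_forall fun x s' _ => ?_
    have h1 : HasDerivAt (fun s' : ℝ => -(s' * x) - κ * ein x) (-x) s' := by
      simpa using ((hasDerivAt_id s').mul_const x).neg.sub_const (κ * ein x)
    exact h1.exp.congr_deriv (by ring)

end rosserAdjointP

namespace rosserAdjointP

/-! ### The adjoint equation `(s p(s))' = κ p(s) − κ p(s + 1)` -/

/-- `x e^{−sx} → 0` as `x → ∞` (`s > 0`). [folklore] -/
theorem _root_.Literature.NumberTheory.Sieve.tendsto_mul_exp_neg_mul {s : ℝ} (hs : 0 < s) :
    Tendsto (fun x : ℝ => x * Real.exp (-(s * x))) atTop (𝓝 0) := by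
  have h := (isLittleO_pow_exp_pos_mul_atTop 1 hs).tendsto_div_nhds_zero
  refine h.congr fun x => ?_
  rw [pow_one, Real.exp_neg, div_eq_mul_inv]

/-- The integration by parts behind [Greaves2001, (3.4)–(3.6)]: for `κ ≥ 0` and `s > 0`,
`∫_0^∞ (1 − s x) e^{−sx − κ Ein x} dx = κ (p_κ(s) − p_κ(s + 1))`, obtained by integrating the
derivative of `x e^{−sx − κ Ein x}` over `(0, ∞)` and using `x Ein'(x) = 1 − e^{−x}`.
[cite: Greaves2001, §4.2.3 (3.4)–(3.6)] -/
theorem integral_one_sub_mul (κ s : ℝ) (hκ : 0 ≤ κ) (hs : 0 < s) :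
    ∫ x in Ioi 0, (1 - s * x) * Real.exp (-(s * x) - κ * ein x) =
      κ * rosserAdjointP κ s - κ * rosserAdjointP κ (s + 1) := by
  -- `G x = x e^{-sx - κ Ein x}` and its derivative
  set E : ℝ → ℝ := fun x => Real.exp (-(s * x) - κ * ein x) with hE
  set G : ℝ → ℝ := fun x => x * E x with hG
  set G' : ℝ → ℝ := fun x => (1 - s * x) * E x - κ * E x + κ * Real.exp (-((s + 1) * x) - κ * ein x)
    with hG'
  have hderiv : ∀ x : ℝ, HasDerivAt G (G' x) x := by
    intro x
    have h1 : HasDerivAt (fun x : ℝ => -(s * x) - κ * ein x) (-s - κ * einKernel x) x := by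
      have := ((hasDerivAt_id x).const_mul s).neg.sub ((hasDerivAt_ein x).const_mul κ)
      simp only [id, mul_one] at this
      exact this
    have h2 : HasDerivAt E (E x * (-s - κ * einKernel x)) x := h1.exp
    have h3 := (hasDerivAt_id x).mul h2
    refine h3.congr_deriv ?_
    simp only [id, hG', hE]
    have hk : x * einKernel x = 1 - Real.exp (-x) := mul_einKernel x
    rw [← integrand_mul_exp_neg κ s x]
    have : x * (Real.exp (-(s * x) - κ * ein x) * (-s - κ * einKernel x)) =
        Real.exp (-(s * x) - κ * ein x) * (-(s * x) - κ * (x * einKernel x)) := by ring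
    rw [this, hk]
    ring
  -- integrability of `G'` and the limit of `G`
  have hEi : IntegrableOn E (Ioi 0) := integrableOn_integrand hκ hs
  have hE1i : IntegrableOn (fun x => Real.exp (-((s + 1) * x) - κ * ein x)) (Ioi 0) :=
    integrableOn_integrand hκ (by linarith)
  have hxEi : IntegrableOn (fun x => x * E x) (Ioi 0) := integrableOn_mul_integrand hκ hs
  have hAi : IntegrableOn (fun x => (1 - s * x) * E x) (Ioi 0) := by
    have : (fun x => (1 - s * x) * E x) = fun x => E x - s * (x * E x) := by
      funext x; ring
    rw [this]
    exact hEi.sub (hxEi.const_mul s)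
  have hG'i : IntegrableOn G' (Ioi 0) := (hAi.sub (hEi.const_mul κ)).add (hE1i.const_mul κ)
  have hGlim : Tendsto G atTop (𝓝 0) := by
    have h0 := tendsto_mul_exp_neg_mul hs
    refine squeeze_zero_norm' ?_ h0
    filter_upwards [eventually_ge_atTop (0 : ℝ)] with x hx
    rw [Real.norm_eq_abs, hG, abs_of_nonneg (mul_nonneg hx (Real.exp_pos _).le)]
    exact mul_le_mul_of_nonneg_left (integrand_le hκ s hx) hx
  have hFTC := integral_Ioi_of_hasDerivAt_of_tendsto (f := G) (f' := G') (a := 0) (m := 0)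
    (hderiv 0).continuousAt.continuousWithinAt (fun x _ => hderiv x) hG'i hGlim
  have hG0 : G 0 = 0 := by simp [hG]
  rw [hG0, sub_zero] at hFTC
  -- split the integral of `G'`
  have hsplit : ∫ x in Ioi 0, G' x = (∫ x in Ioi 0, (1 - s * x) * E x) -
      κ * rosserAdjointP κ s + κ * rosserAdjointP κ (s + 1) := by
    have hI3 : Integrable (fun x => κ * E x) (volume.restrict (Ioi 0)) := hEi.const_mul κ
    have hI1 : Integrable (fun x => (1 - s * x) * E x - κ * E x) (volume.restrict (Ioi 0)) :=
      hAi.sub hI3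
    have hI2 : Integrable (fun x => κ * Real.exp (-((s + 1) * x) - κ * ein x))
        (volume.restrict (Ioi 0)) := hE1i.const_mul κ
    simp only [hG']
    rw [integral_add hI1 hI2, integral_sub hAi hI3, MeasureTheory.integral_const_mul,
      MeasureTheory.integral_const_mul, rosserAdjointP_def, rosserAdjointP_def]
  rw [hsplit] at hFTC
  linarith

/-- **The adjoint equation** [Greaves2001, (3.4)–(3.6) with `(a, b) = (κ, −κ)`]:
`(s p_κ(s))' = κ p_κ(s) − κ p_κ(s + 1)` for `κ ≥ 0`, `s > 0`. [cite: Greaves2001, §4.2.3 (3.4)–(3.6)] -/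
theorem hasDerivAt_mul {κ s : ℝ} (hκ : 0 ≤ κ) (hs : 0 < s) :
    HasDerivAt (fun t : ℝ => t * rosserAdjointP κ t)
      (κ * rosserAdjointP κ s - κ * rosserAdjointP κ (s + 1)) s := by
  have h1 := (hasDerivAt_id s).mul (hasDerivAt hκ hs)
  refine h1.congr_deriv ?_
  have hfun : (fun x : ℝ => (1 - s * x) * Real.exp (-(s * x) - κ * ein x)) =
      fun x => Real.exp (-(s * x) - κ * ein x) - s * (x * Real.exp (-(s * x) - κ * ein x)) := by
    funext x; ring
  rw [← integral_one_sub_mul κ s hκ hs, hfun, integral_sub (integrableOn_integrand hκ hs)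
    ((integrableOn_mul_integrand hκ hs).const_mul s), MeasureTheory.integral_const_mul,
    rosserAdjointP_def]
  simp only [id, one_mul]
  ring

/-- **The adjoint equation in the form of `IsSieveAdjoint κ (−κ)`**:
`(s^{1−κ} p_κ(s))' = −κ s^{−κ} p_κ(s + 1)` for `κ ≥ 0`, `s > 0` [Greaves2001, §4.2.2 (2.10)].
[cite: Greaves2001, §4.2.2 (2.10) and §4.2.3 (3.6)] -/
theorem hasDerivAt_rpow_mul {κ s : ℝ} (hκ : 0 ≤ κ) (hs : 0 < s) :
    HasDerivAt (fun t : ℝ => t ^ (1 - κ) * rosserAdjointP κ t)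
      (-κ * s ^ (-κ) * rosserAdjointP κ (s + 1)) s := by
  have h1 : HasDerivAt (fun t : ℝ => t ^ (-κ)) (-κ * s ^ (-κ - 1)) s :=
    Real.hasDerivAt_rpow_const (Or.inl hs.ne')
  have h2 := h1.mul (hasDerivAt_mul hκ hs)
  have heq : (fun t : ℝ => t ^ (1 - κ) * rosserAdjointP κ t) =ᶠ[𝓝 s]
      fun t => t ^ (-κ) * (t * rosserAdjointP κ t) := by
    filter_upwards [Ioi_mem_nhds hs] with t (ht : 0 < t)
    rw [← mul_assoc, sub_eq_add_neg, Real.rpow_add ht, Real.rpow_one, mul_comm (t : ℝ)]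
  refine (h2.congr_of_eventuallyEq heq).congr_deriv ?_
  have hs1 : s ^ (-κ - 1) * s = s ^ (-κ) := by
    rw [sub_eq_add_neg, Real.rpow_add hs, Real.rpow_neg_one, mul_assoc, inv_mul_cancel₀ hs.ne',
      mul_one]
  calc -κ * s ^ (-κ - 1) * (s * rosserAdjointP κ s) +
        s ^ (-κ) * (κ * rosserAdjointP κ s - κ * rosserAdjointP κ (s + 1))
      = -κ * (s ^ (-κ - 1) * s) * rosserAdjointP κ s +
        s ^ (-κ) * (κ * rosserAdjointP κ s - κ * rosserAdjointP κ (s + 1)) := by ring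
    _ = -κ * s ^ (-κ) * rosserAdjointP κ (s + 1) := by rw [hs1]; ring

/-! ### `s p_κ(s) → 1` [Greaves2001, (3.8)] -/

/-- The substitution `u = s x`: `s p_κ(s) = ∫_0^∞ e^{−u − κ Ein(u/s)} du` for `s > 0`. [folklore] -/
theorem mul_eq_integral {κ s : ℝ} (hs : 0 < s) :
    s * rosserAdjointP κ s = ∫ u in Ioi 0, Real.exp (-u - κ * ein (u / s)) := by
  have h := integral_comp_mul_left_Ioi (fun u => Real.exp (-u - κ * ein (u / s))) 0 hs
  simp only [mul_zero] at h
  have h' : (fun x => Real.exp (-(s * x) - κ * ein (s * x / s))) =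
      fun x => Real.exp (-(s * x) - κ * ein x) := by
    funext x; rw [mul_div_cancel_left₀ _ hs.ne']
  rw [h'] at h
  rw [rosserAdjointP_def, h, smul_eq_mul, ← mul_assoc, mul_inv_cancel₀ hs.ne', one_mul]

/-- **Normalisation at infinity** [Greaves2001, (3.8) with `a + b = 0`]: `s p_κ(s) → 1` as `s → ∞`
(`κ ≥ 0`; dominated convergence in `s p_κ(s) = ∫_0^∞ e^{−u − κ Ein(u/s)} du`).
[cite: Greaves2001, §4.2.3 (3.8)] -/
theorem tendsto_mul {κ : ℝ} (hκ : 0 ≤ κ) :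
    Tendsto (fun s : ℝ => s * rosserAdjointP κ s) atTop (𝓝 1) := by
  have hlim : Tendsto (fun s : ℝ => ∫ u in Ioi 0, Real.exp (-u - κ * ein (u / s))) atTop
      (𝓝 (∫ u in Ioi (0 : ℝ), Real.exp (-u))) := by
    refine tendsto_integral_filter_of_dominated_convergence (fun u => Real.exp (-u)) ?_ ?_ ?_ ?_
    · refine Eventually.of_forall fun s => ?_
      have : Continuous fun u => Real.exp (-u - κ * ein (u / s)) := by
        have := continuous_ein; fun_prop
      exact this.aestronglyMeasurable
    · filter_upwards [eventually_gt_atTop (0 : ℝ)] with s hs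
      refine (ae_restrict_mem measurableSet_Ioi).mono fun u (hu : 0 < u) => ?_
      rw [Real.norm_eq_abs, Real.abs_exp, Real.exp_le_exp]
      nlinarith [ein_nonneg (div_pos hu hs).le]
    · have h := exp_neg_integrableOn_Ioi 0 one_pos
      simp only [neg_mul, one_mul] at h
      exact h
    · refine (ae_restrict_mem measurableSet_Ioi).mono fun u (_ : 0 < u) => ?_
      have h1 : Tendsto (fun s : ℝ => u / s) atTop (𝓝 0) := tendsto_const_nhds.div_atTop tendsto_id
      have h2 : Tendsto (fun s : ℝ => ein (u / s)) atTop (𝓝 0) := by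
        have := (continuous_ein.tendsto 0).comp h1
        rwa [ein_zero] at this
      have h3 : Tendsto (fun s : ℝ => -u - κ * ein (u / s)) atTop (𝓝 (-u)) := by
        simpa using (tendsto_const_nhds (x := -u)).sub (h2.const_mul κ)
      exact (Real.continuous_exp.tendsto _).comp h3
  rw [integral_exp_neg_Ioi_zero] at hlim
  refine hlim.congr' ?_
  filter_upwards [eventually_gt_atTop (0 : ℝ)] with s hs
  exact (mul_eq_integral hs).symm

/-- `p_κ(s) ∼ 1/s`, in `O`-form: `p_κ = O(s⁻¹)` at infinity (`κ ≥ 0`). [folklore] -/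
theorem isBigO_inv {κ : ℝ} (hκ : 0 ≤ κ) :
    rosserAdjointP κ =O[atTop] fun s : ℝ => s⁻¹ := by
  have h := (tendsto_mul hκ).isBigO_one ℝ
  refine (h.mul (isBigO_refl (fun s : ℝ => s⁻¹) atTop)).congr' ?_ ?_
  · filter_upwards [eventually_gt_atTop (0 : ℝ)] with s hs
    show s * rosserAdjointP κ s * s⁻¹ = rosserAdjointP κ s
    field_simp
  · exact Eventually.of_forall fun s => by simp

end rosserAdjointP

/-! ### `p_κ` is an adjoint in the sense of `IsSieveAdjoint κ (−κ)`; the constant `A_κ` -/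

/-- `p_κ` solves the adjoint equation of the `P = F + f` equation on `(0, ∞)`:
`IsSieveAdjoint κ (−κ) p_κ` for `κ ≥ 0` [Greaves2001, (2.3), (3.6), (3.17)].
[cite: Greaves2001, §4.2.3 (3.6) and (3.17)] -/
theorem isSieveAdjoint_rosserAdjointP {κ : ℝ} (hκ : 0 ≤ κ) :
    IsSieveAdjoint κ (-κ) (rosserAdjointP κ) :=
  fun _ hs => rosserAdjointP.hasDerivAt_rpow_mul hκ hs

/-- **The constant of the `β`-sieve** [Greaves2001, Lemma 4.2.5 (4.11)]: for every normalised
solution of the `β`-sieve system of dimension `κ ≥ 0` with `β > 1`,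
`A = 2 (β − 1)^{κ−1} / p_κ(β − 1)` (from `IsBetaSieveSolution.const_eq` with the adjoint `p_κ`,
`s p_κ(s) → 1`). For `κ = 1` this is `A_1 = 2/p_1(1) = 2e^γ`. [cite: Greaves2001, Lemma 4.2.5 (4.11)] -/
theorem IsBetaSieveSolution.const_eq_rosserAdjointP {κ : ℝ} {F f : ℝ → ℝ} {β A : ℝ}
    (h : IsBetaSieveSolution κ F f β A) (hκ : 0 ≤ κ) (hβ : 1 < β) :
    A = 2 * (β - 1) ^ (κ - 1) / rosserAdjointP κ (β - 1) := by
  have h1 := h.const_eq hβ (isSieveAdjoint_rosserAdjointP hκ) (rosserAdjointP.tendsto_mul hκ)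
  have hb : 0 < β - 1 := by linarith
  have hp : 0 < rosserAdjointP κ (β - 1) := rosserAdjointP.pos hκ hb
  rw [eq_div_iff hp.ne']
  have hpow : (β - 1) ^ (1 - κ) * (β - 1) ^ (κ - 1) = 1 := by
    rw [← Real.rpow_add hb, show (1 - κ) + (κ - 1) = 0 by ring, Real.rpow_zero]
  calc A * rosserAdjointP κ (β - 1)
      = A * ((β - 1) ^ (1 - κ) * (β - 1) ^ (κ - 1)) * rosserAdjointP κ (β - 1) := by
        rw [hpow, mul_one]
    _ = A * (β - 1) ^ (1 - κ) * rosserAdjointP κ (β - 1) * (β - 1) ^ (κ - 1) := by ring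
    _ = 2 * (β - 1) ^ (κ - 1) := by rw [h1]

/-- The constant of the least-`β` pin: for `κ ≥ 1`, granted existence (`exists_isBetaSieveData`),
`betaSieveConst κ = 2 (siftingLimit κ − 1)^{κ−1} / p_κ(siftingLimit κ − 1)` (every normalised
solution obeys [Greaves2001, (4.11)]; `β > 1` by `IsBetaSieveSolution.one_lt`).
[cite: Greaves2001, Lemma 4.2.5 (4.11)] -/
theorem betaSieveConst_eq (hex : exists_isBetaSieveData) {κ : ℝ} (hκ : 1 ≤ κ) :
    betaSieveConst κ = 2 * (siftingLimit κ - 1) ^ (κ - 1) / rosserAdjointP κ (siftingLimit κ - 1) :=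
  have h := isBetaSieveSolution_upperSieveFun_lowerSieveFun hex (by linarith)
  h.const_eq_rosserAdjointP (by linarith) (h.one_lt hκ)

end Literature.NumberTheory.Sieve
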